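import Summits.QuantumFields.YangMills.Theorems.FemtoTransferGapSlabFlowLift
import Summits.QuantumFields.GaugeBoot.OrbitAverages
import Summits.Ventures.LatticeQCDFlow.Scoring.WilsonFlowAxisPermutationCovariance
import HarnessLib

/-!
# Axis permutations permute the (flowed) Polyakov triple: the flowed Polyakov lift is `S₃`-equivariant

Fleet-service module of seat ym-infvol-p1 g5 (route `LuscherReduction`, femto rung R2b1; bears on crux child `DressedRitz` =
stmt-QuantumFields-20205, line «polyakovlift», stub S-STAT `stub_liftStatics`).  Companion of `…FemtoTransferGapAxisPermutation.lean` (the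
transfer operator and its raw vacua are invariant under permutations of the coordinate axes, tree `configPerm π`): here the OBSERVABLE side.
The two ingredients already in the tree are REUSED, not restated: the Wilson flow commutes with axis permutations
(`Summit.Ventures.LatticeQCDFlow.Scoring.wilsonFlow_configPerm`, by flow-line uniqueness) and straight-line holonomies of the permuted field
(`Summit.QuantumFields.GaugeBoot.lineHolonomy_configPerm`).

* `polyakovSite_configPerm`, `polyakovSite_zero_configPerm` — the one-site configuration of Polyakov holonomies of `configPerm π U` at `x` is
  `configPerm π` (on the one-point torus: the three links permuted by the SAME `π`) of the Polyakov triple of `U` at `σx`, `σ = sitePerm π⁻¹`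
  (`σ0 = 0`);
* ★ `flowLiftAt_zero_configPerm : flowLiftAt 0 t f (configPerm π U) = flowLiftAt 0 t (f ∘ configPerm π) U` — the flowed Polyakov lift
  intertwines the axis permutations of the fine lattice and of the one-site model.

HONEST FRAMING: fixed-lattice symmetry bookkeeping; no renormalisation-group content; nothing here bears on infinite volume, the continuum limit
or the Clay gap.  References: M. Lüscher, JHEP 08 (2010) 071, §2 [cite: Luscher2010, §2]; M. Lüscher, NPB 219 (1983) 233, §2 [cite: Luscher1983, §2].
-/

set_option autoImplicit false

noncomputable section

open MeasureTheory Filter Topology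
open Literature.MathematicalPhysics.QuantumFieldTheory
open Literature.MathematicalPhysics.QuantumLattice
open scoped BigOperators

namespace Summit.QuantumFields.YangMills.Theorems.FemtoTransferGap

/-! ## §1 Polyakov holonomies of the permuted field -/

section Polyakov

variable {G : Type*} [Group G] [MeasurableSpace G] {L : ℕ}

/-- **The Polyakov triple of the permuted field at `x` is the permuted Polyakov triple of the field at `σx`** (as one-site configurations:
`configPerm π` on the one-point torus permutes the three links; `GaugeBoot.lineHolonomy_configPerm`). [cite: Luscher1983, §2] -/
theorem polyakovSite_configPerm (π : Equiv.Perm (Fin 3)) (x : Site 3 L) (U : GaugeConfig 3 L G) :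
    polyakovSite x (configPerm π U) = configPerm π (polyakovSite (sitePerm π.symm x) U) := by
  funext e
  rw [configPerm_apply]
  simp only [polyakovSite, Summit.QuantumFields.GaugeBoot.lineHolonomy_configPerm]

/-- At the base point `0` (fixed by every axis permutation): `polyakovSite 0 (P_π U) = P_π (polyakovSite 0 U)`. [cite: Luscher1983, §2] -/
theorem polyakovSite_zero_configPerm (π : Equiv.Perm (Fin 3)) (U : GaugeConfig 3 L G) :
    polyakovSite 0 (configPerm π U) = configPerm π (polyakovSite 0 U) := by
  rw [polyakovSite_configPerm]
  rfl

end Polyakov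

/-! ## §2 ★ The flowed Polyakov lift intertwines the two axis-permutation actions -/

section Lift

variable {L : ℕ} [NeZero L]

/-- **`(f∘Π_t)(P_π U) = ((f ∘ P_π)∘Π_t)(U)`** at base point `0`: the flowed Polyakov lift of `f` evaluated on the permuted fine field is the
flowed Polyakov lift of the permuted one-site function `f ∘ configPerm π` (the flow commutes with `P_π`:
`LatticeQCDFlow.Scoring.wilsonFlow_configPerm`). [cite: Luscher2010, §2] [cite: Luscher1983, §2] -/
theorem flowLiftAt_zero_configPerm (π : Equiv.Perm (Fin 3)) (t : ℝ) (f : GaugeConfig 3 1 SU2 → ℝ) (U : GaugeConfig 3 L SU2) :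
    flowLiftAt 0 t f (configPerm π U) = flowLiftAt 0 t (fun V => f (configPerm π V)) U := by
  simp only [flowLiftAt, Summit.Ventures.LatticeQCDFlow.Scoring.wilsonFlow_configPerm, polyakovSite_zero_configPerm]

/-- Function form: `flowLiftAt 0 t f ∘ configPerm π = flowLiftAt 0 t (f ∘ configPerm π)`. [cite: Luscher2010, §2] -/
theorem flowLiftAt_zero_comp_configPerm (π : Equiv.Perm (Fin 3)) (t : ℝ) (f : GaugeConfig 3 1 SU2 → ℝ) :
    (fun U : GaugeConfig 3 L SU2 => flowLiftAt 0 t f (configPerm π U)) = flowLiftAt 0 t (fun V => f (configPerm π V)) :=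
  funext fun U => flowLiftAt_zero_configPerm π t f U

end Lift

end Summit.QuantumFields.YangMills.Theorems.FemtoTransferGap

end
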